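/-
Copyright (c) 2026 the pub-hodgecm-mathlib formalisation cell (harness21).  Prover seat hodgecm-mathlib-K2Liu-p03 (g7): Track B «K2-LIT»,
#184♮ = hLiu418 = stmt-HodgeConjecture-24832, road `K2_Liu`, socket #42S payer road, organ S4 (glue), brick (asm-3F) of my (asm-3) census
`K2/K2Liu-p03/g7/CENSUS-asm3-StdSectionCoherentExpansion.K2Liu-p03-g7.md` (STEP F: from the value identity at `s₀` to #42S's span identity for all `s`).
-/
import Summits.HodgeConjecture.HodgeConjecture.Theorems.K2LiuStdExtensionDatumMonotone   -- ★ `stdExtension_apply_eq_of_flat` (+ ★ O42.3d `stdExtension`)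
import HarnessLib

/-!
# Crux `HLiu418`, road `K2_Liu`, socket #42S, organ S4, brick (asm-3F): THE STANDARD EXTENSION OF A TWISTED FINITE SUM —
# a value identity `f(s₀) = Σᵢ caᵢ · θᵢ · Fᵢ + Σⱼ cbⱼ · Gⱼ` of a STANDARD family becomes #42S's span identity `f s h = Σᵢ caᵢ · θᵢ(h) · stdExtension 𝒦 s₀ Fᵢ s h + Σⱼ cbⱼ · stdExtension 𝒦 s₀ Gⱼ s h`

Cell `hodgecm-mathlib`, crux item hLiu418 = `stmt-HodgeConjecture-24832`; squad K2 ∕ K2Liu; prover K2Liu-p03 (g7).  THEOREMS ONLY (no `def`, no instance, no notation,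
no named-fact hypothesis, no `sorry`); lane `--supports stmt-HodgeConjecture-24832 --as helper`.

The socket #42S (U6 `sig_K2LiuStandardSectionSpanBySWGenerators`) asks for the span identity AS FAMILIES, pointwise in `(s, h)`, with the generator written
`detChar αᵢ h * stdExtension 𝒦 s₀ (swSectionTensor …) s h` (the twist OUTSIDE the standard extension).  The organ work ((asm-3), S1, S2, S5) produces an identity of
VALUES at `s₀`.  This file is the bookkeeping from one to the other, once and for all, for ANY coefficients, twists `θᵢ : H(𝔸) → ℂ` and functions `Fᵢ, Gⱼ`:
* `stdExtension_apply_mul` — `stdExtension 𝒦 s₀ (fun h => θ h * φ h) s h = θ h * stdExtension 𝒦 s₀ φ s h` (★ O42.3d: `stdExtension 𝒦 s₀ φ s h = |det_Δ p_h|^{2(s−s₀)} · φ h`);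
* `stdExtension_apply_finset_sum` — additivity over a `Finset`;
* **`eq_twistedSum_stdExtension_of_apply_eq`** — for a 𝒦-STANDARD family `f` (flat, so `f s h = stdExtension 𝒦 s₀ (f s₀) s h`, ★ `stdExtension_apply_eq_of_flat`) and a value identity
  `∀ h, f s₀ h = Σᵢ caᵢ * (θᵢ h * Fᵢ h) + Σⱼ cbⱼ * Gⱼ h`: `∀ s h, f s h = Σᵢ caᵢ * (θᵢ h * stdExtension 𝒦 s₀ Fᵢ s h) + Σⱼ cbⱼ * stdExtension 𝒦 s₀ Gⱼ s h` — #42S's last clause, shape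
  for shape (`θᵢ h := detChar αᵢ h`, `Fᵢ := swSectionTensor … Φᵢ`, `Gⱼ s h` read as `stdExtension 𝒦 s₀ Gⱼ s h` for the residue-free families `gbⱼ := stdExtension 𝒦 s₀ Gⱼ`).
[KudlaRallis1994, §1]; [Tan1999, §1 p. 166]; [HarrisKudlaSweet1996, §1 (1.17)].
HONEST LABEL.  Count-neutral helper: `HC_CM` is proved only modulo the 7 printed citations (2 remaining named inputs: hLiu418 = `stmt-HodgeConjecture-24832`,
h413 = `stmt-HodgeConjecture-24833`) until rung 0 closes.
-/

set_option autoImplicit false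
set_option linter.dupNamespace false -- the mandated namespace repeats `HodgeConjecture.HodgeConjecture`

noncomputable section

open scoped Matrix
open NumberField IsDedekindDomain
open Literature.NumberTheory.Automorphic hiding IsKFinite
open Literature.NumberTheory.GaloisRepresentations
open Literature.NumberTheory.GelbartRogawski1991 Literature.NumberTheory.GelbartRogawski1991.GRConstruction
open Literature.NumberTheory.K2Lit.SiegelDoubled
open Summit.HodgeConjecture.HodgeConjecture.Cruxes.HLiu418.K2LiuStdExtensionDatumMonotone

namespace Summit.HodgeConjecture.HodgeConjecture.Cruxes.HLiu418.K2LiuStdExtensionTwistedSum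

variable {L : Type} [Field L] [NumberField L] [IsCMField L]
variable {N M n : ℕ} {e : Fin N × Fin M ≃ Fin n}
  {dV : Fin N → L} {hdV : ∀ i, IsCMField.complexConj L (dV i) = dV i}
  {dW : Fin M → L} {hdW : ∀ i, IsCMField.complexConj L (dW i) = dW i}
variable (𝒦 : IwasawaDatum L e dV hdV dW hdW) (s₀ : ℂ)

/-! ## §1 Twists and finite sums pass through the standard extension -/

/-- **`stdExtension 𝒦 s₀ (θ · φ) s h = θ h · stdExtension 𝒦 s₀ φ s h`** — a pointwise twist factor passes through (★ O42.3d's definition). [cite: KudlaRallis1994, §1] [cite: Tan1999, §1 p. 166] -/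
theorem stdExtension_apply_mul (θ φ : HA L e dV hdV dW hdW → ℂ) (s : ℂ) (h : HA L e dV hdV dW hdW) :
    stdExtension 𝒦 s₀ (fun x => θ x * φ x) s h = θ h * stdExtension 𝒦 s₀ φ s h := by
  simp only [stdExtension]
  ring

/-- **`stdExtension 𝒦 s₀ (c • φ) s h = c · stdExtension 𝒦 s₀ φ s h`** (constant twist). [cite: KudlaRallis1994, §1] -/
theorem stdExtension_apply_const_mul (c : ℂ) (φ : HA L e dV hdV dW hdW → ℂ) (s : ℂ) (h : HA L e dV hdV dW hdW) :
    stdExtension 𝒦 s₀ (fun x => c * φ x) s h = c * stdExtension 𝒦 s₀ φ s h :=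
  stdExtension_apply_mul 𝒦 s₀ (fun _ => c) φ s h

/-- **additivity over a `Finset`**: `stdExtension 𝒦 s₀ (Σ_{i∈I} φᵢ) s h = Σ_{i∈I} stdExtension 𝒦 s₀ φᵢ s h`. [cite: KudlaRallis1994, §1] [cite: Tan1999, §1 p. 166] -/
theorem stdExtension_apply_finset_sum {ι : Type*} (I : Finset ι) (φ : ι → HA L e dV hdV dW hdW → ℂ) (s : ℂ) (h : HA L e dV hdV dW hdW) :
    stdExtension 𝒦 s₀ (fun x => ∑ i ∈ I, φ i x) s h = ∑ i ∈ I, stdExtension 𝒦 s₀ (φ i) s h := by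
  simp only [stdExtension]
  rw [Finset.mul_sum]

/-- the two-block form used by #42S: `stdExtension` of `Σᵢ caᵢ·θᵢ·Fᵢ + Σⱼ cbⱼ·Gⱼ`. [cite: KudlaRallis1994, §1] [cite: Tan1999, §1 p. 166] -/
theorem stdExtension_apply_twistedSum {ι κ : Type*} (I : Finset ι) (J : Finset κ) (ca : ι → ℂ) (θ F : ι → HA L e dV hdV dW hdW → ℂ)
    (cb : κ → ℂ) (G : κ → HA L e dV hdV dW hdW → ℂ) (s : ℂ) (h : HA L e dV hdV dW hdW) :
    stdExtension 𝒦 s₀ (fun x => (∑ i ∈ I, ca i * (θ i x * F i x)) + ∑ j ∈ J, cb j * G j x) s h =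
      (∑ i ∈ I, ca i * (θ i h * stdExtension 𝒦 s₀ (F i) s h)) + ∑ j ∈ J, cb j * stdExtension 𝒦 s₀ (G j) s h := by
  simp only [stdExtension]
  rw [mul_add, Finset.mul_sum, Finset.mul_sum]
  congr 1
  · exact Finset.sum_congr rfl fun i _ => by ring
  · exact Finset.sum_congr rfl fun j _ => by ring

/-! ## §2 From the value identity at `s₀` to the span identity for all `s` -/

/-- **(asm-3F) — A VALUE IDENTITY OF A STANDARD FAMILY AT `s₀` IS #42S's SPAN IDENTITY FOR ALL `s`.**  If `f` is `𝒦`-standard (hence FLAT: `f s h = stdExtension 𝒦 s₀ (f s₀) s h`,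
★ `stdExtension_apply_eq_of_flat`) and `f s₀ h = Σ_{i∈I} caᵢ · (θᵢ h · Fᵢ h) + Σ_{j∈J} cbⱼ · Gⱼ h` for all `h`, then for all `s, h`:
`f s h = Σ_{i∈I} caᵢ · (θᵢ h · stdExtension 𝒦 s₀ Fᵢ s h) + Σ_{j∈J} cbⱼ · stdExtension 𝒦 s₀ Gⱼ s h`.  (#42S: `I = J = univ`, `θᵢ = detChar αᵢ`, `Fᵢ = swSectionTensor … Φᵢ`,
`gbⱼ = stdExtension 𝒦 s₀ Gⱼ`.) [cite: KudlaRallis1994, §1] [cite: Tan1999, §1 p. 166] [cite: HarrisKudlaSweet1996, §1 (1.17)] -/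
theorem eq_twistedSum_stdExtension_of_apply_eq {χ : HeckeCharacter L} {f : ℂ → HA L e dV hdV dW hdW → ℂ} (hf : IsStandardSectionFamily 𝒦 χ f)
    {ι κ : Type*} (I : Finset ι) (J : Finset κ) (ca : ι → ℂ) (θ F : ι → HA L e dV hdV dW hdW → ℂ) (cb : κ → ℂ) (G : κ → HA L e dV hdV dW hdW → ℂ)
    (hval : ∀ h : HA L e dV hdV dW hdW, f s₀ h = (∑ i ∈ I, ca i * (θ i h * F i h)) + ∑ j ∈ J, cb j * G j h)
    (s : ℂ) (h : HA L e dV hdV dW hdW) :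
    f s h = (∑ i ∈ I, ca i * (θ i h * stdExtension 𝒦 s₀ (F i) s h)) + ∑ j ∈ J, cb j * stdExtension 𝒦 s₀ (G j) s h := by
  rw [← stdExtension_apply_eq_of_flat hf.1.1 hf.2.2 s₀ s h, ← stdExtension_apply_twistedSum 𝒦 s₀ I J ca θ F cb G s h]
  exact congrFun (congrFun (congrArg (stdExtension 𝒦 s₀) (funext hval)) s) h

/-- **(asm-3F), `Fintype` form** (the literal shape of U6 :866's last clause: `∑ i, …` over `Fin ma`, `∑ j, …` over `Fin mb`). [cite: KudlaRallis1994, §1] [cite: Tan1999, §1 p. 166] -/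
theorem eq_twistedSum_stdExtension_of_apply_eq_univ {χ : HeckeCharacter L} {f : ℂ → HA L e dV hdV dW hdW → ℂ} (hf : IsStandardSectionFamily 𝒦 χ f)
    {ι κ : Type*} [Fintype ι] [Fintype κ] (ca : ι → ℂ) (θ F : ι → HA L e dV hdV dW hdW → ℂ) (cb : κ → ℂ) (G : κ → HA L e dV hdV dW hdW → ℂ)
    (hval : ∀ h : HA L e dV hdV dW hdW, f s₀ h = (∑ i, ca i * (θ i h * F i h)) + ∑ j, cb j * G j h)
    (s : ℂ) (h : HA L e dV hdV dW hdW) :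
    f s h = (∑ i, ca i * (θ i h * stdExtension 𝒦 s₀ (F i) s h)) + ∑ j, cb j * stdExtension 𝒦 s₀ (G j) s h :=
  eq_twistedSum_stdExtension_of_apply_eq 𝒦 s₀ hf Finset.univ Finset.univ ca θ F cb G hval s h

/-- **standard extensions of standard extensions**: for the residue-free families `gbⱼ := stdExtension 𝒦 s₀ Gⱼ` the value at `s₀` is `Gⱼ` back (★ `stdExtension_self`), so the
value identity may be stated with `gbⱼ s₀` in place of `Gⱼ`. [cite: KudlaRallis1994, §1] -/
theorem stdExtension_apply_self (φ : HA L e dV hdV dW hdW → ℂ) (h : HA L e dV hdV dW hdW) : stdExtension 𝒦 s₀ φ s₀ h = φ h := by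
  rw [stdExtension_self]

end Summit.HodgeConjecture.HodgeConjecture.Cruxes.HLiu418.K2LiuStdExtensionTwistedSum

end
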